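/-
Copyright: public-domain mathematics (Bałaban 1985/1987/1988); this file types a published two-line argument.

# B13DerivZeroGauge — the leaf (L3′) «no first-order term» of `B10Eq61PerSite` §3b is the printed step
# (26) ⇒ (31) ⇒ (32) of [Balaban1985UV3] (global gauge invariance + semisimplicity), kernel-certified

Cell `pub-balaban`, PAPER SUB-CELL B13 = [Balaban1988RG2Cluster] (T. Bałaban, *Renormalization group approach to
lattice gauge field theories. II. Cluster expansions*, Commun. Math. Phys. **116** (1988) 1–22), lineage b2b-balaban-b13,
generation 15 (v1; v1.1 = generation 16, a DOCFIX; this is v1.2 = generation 17, §3b ADDED + two deferred docstring fixes — see VERSIONS below).  Sibling of `B13LogHalfRadius`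
(gen 14); COMPANION to `B10Eq61PerSite` v1.1 (b10 lineage), whose
second-order theorems `logHalfBound_secondOrder_of_R21` / `bound118_secondOrder_of_R21` /
`logHalfBound_secondOrder_twoRegime_of_R21` carry the hypothesis `h0 : DerivZeroAlongV sp' E line` — LEAF (L3′), *"NO
FIRST-ORDER TERM along the X-dependent line (the (32)-shape) … the vanishing follows from gauge invariance +
semi-simplicity for ANY gauge invariant localized function, but that derivation is the paper's, not the kernel's"*
(docstring of `B10Eq61PerSite.DerivZeroAlongV`).  THIS MODULE MAKES THAT DERIVATION THE KERNEL'S: (L3′) is DISCHARGED BY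
NAME from (a) differentiability of each localized piece at the unit configuration in an exponential chart, (b) invariance
of each piece under the GLOBAL (constant) gauge group acting linearly in the chart, (c) the detecting property of the
generators ("𝔤 semisimple"), via the chain rule along any line that passes differentiably through the unit configuration
— exactly the printed argument quoted in §0.  Nothing of Bałaban's objects is constructed or asserted; every theorem is
bookkeeping over hypotheses, tagged [folklore] (calculus / linear algebra) or [cite: …] (the typed shape of a printed
sentence).  The cross-read of `B10Eq61PerSite` v1.1 (cell GAPS C-pv03-49) lists the unprinted inputs of the b10
second-order route, as claims about print's constants, as exactly {(L3′) for the (61)-pieces — *"(32) printed for 𝒫′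
only"* —, a absolute} (C-adv2-65 adds: on WHICH space of [II] p. 15 the undifferenced bound holds); after this module
the first is reduced to the printed (a)–(c): (32) is not special to 𝒫′₁ — it holds for EVERY gauge invariant function
differentiable at the unit configuration, and [Balaban1985UV3] p. 272 prints the (63)-pieces *"gauge invariant,
localized"* (cell GAPS C-B13-32, G-B13-12a UPDATE (b13-g15)).

VERSIONS.  v1 = gate p184821 (generation 15).  v1.1 (generation 16, this file) = DOCFIX after the three cross-reads of v1
(cell GAPS C-adv2-66 with remarks R1–R3 (adv2-g44), C-pv27-59 with R-pv27-64/65 (pv27-g10), C-B13-32 UPDATE (b10-g19) —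
all verdicts ok, 0 objections): §0 gains three LOCATED sentences read on the renders as images by generation 16
([Balaban1985UV3] p. 272 — the first-order terms of (63) at U_{k+1} = 1 are cancelled by the second term of (61);
[Balaban1988RG2Cluster] pp. 21–22 — the end of the closing remark; [Balaban1987RG1] (1.10) p. 262 — the action of a gauge
transformation on (𝐔, 𝐉)); HONEST SCOPE gains (iv′) (what `InChart` pins: the fixed-point reading, R1) and (vii)
(absolute vs relative detecting, C-B13-32 UPDATE); the dictionary and four docstrings are sharpened (R3: one-parameter
FAMILIES — only the velocity is used; R-pv27-64: which chart data are cut off at d₀); ONE [folklore] lemma is ADDED,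
`line_zero_eq_of_inChart` (the kernel form of (iv′)).  Every v1 declaration — name, binders, statement, proof — is
byte-identical (the consumer `B10Eq61Leaves` v1 (b10-g19, gate p185047) opens seven of them by name); imports unchanged.
v1.2 (generation 17, this file) = ONE SUBSTANTIVE ADDITION + the two LOW docstring remarks deferred to it (cell convention: no
docstring-only revisions).  ADDED §3b (three declarations, [folklore]/[cite]): `lieSubalgebra_le_span_comm` — in ANY ring that is a
ℂ-algebra, with the commutator bracket, a finite-dimensional SEMISIMPLE Lie subalgebra 𝔥 that is ℂ-spanned by a family `lam` lies in
the ℂ-span of the commutators `lam l · y − y · lam l` (y over the whole ring) — the GENERATOR-LEVEL relative detecting statement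
that the consumer `B10Eq31GlobalConj` v1 (b10-g21, gate p185846) takes as its per-bond binder `hcomm` and whose HONEST SCOPE (iv)
left *"[𝔤, M_N] ⊇ [𝔤ᶜ, 𝔤ᶜ] = 𝔤ᶜ … not re-proved here for matrices"* (cell GAPS C-B13-37 item (ii)); its configuration-level
corollary `mem_closure_span_comm_of_mem`; and the negative control `one_not_mem_span_comm_complex` (ℂ = 𝔲(1)ᶜ: nothing is
detected — *"It is the only place we use the semi-simplicity"*).  DOCSTRINGS: HONEST SCOPE (iv′) re-worded per cell GAPS
C-adv2-68 (adv2-g46: the 𝐔-derivative at (1, 𝐉) is COVARIANT under all of G and INVARIANT only under the stabiliser of 𝐉), which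
also removes the stray punctuation noted in C-adv4-82 (adv4-g43); HONEST SCOPE (vii) gains the generator-level sentence suggested
in C-B13-32 UPDATE (b10-g19).  Every v1/v1.1 declaration — name, binders, statement, proof — is byte-identical; imports unchanged.

## §0 Sources, verbatim (renders of the cell READ AS IMAGES by this generation; journal page = PDF page)

[Balaban1985UV3] = T. Bałaban, *Ultraviolet stability of three-dimensional lattice pure gauge field theories*, Commun.
Math. Phys. **102** (1985) 255–275 (= ref. [16] of the paper under audit).
* p. 263 (render `1985-cmp102-uv-stability-3d-p009`): *"equalities hold 𝒫′₁(g₀, X, U₁^𝓊) = 𝒫′₁(g₀, X, U₁), (26) for all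
  gauge transformations 𝓊. The second is a localization property with respect to U₁. … The third property is the
  analyticity with respect to U₁. These properties follow from the results of previous papers"*; *"By the gauge
  invariance (26), we have 𝒫′₁(g₀, X, U₁) = 𝒫′₁(g₀, X, exp i𝓗(B)), (29) and we expand the function with respect to
  𝓗(B)."*
* p. 264 (render `…-p010`): *"The gauge invariance (26) implies the invariance with respect to the global transformations
  R(U), U ∈ G, hence the equality R(U)((δ/δ𝓗(b))𝒫′₁)(g₀, X, 1) = ((δ/δ𝓗(b))𝒫′₁)(g₀, X, 1). (31) We have to notice
  only that (26) holds for all regular gauge field configurations, not only for the minimal configurations U₁. The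
  derivative in the above formula is an element of the Lie algebra 𝔤, and by the assumption that 𝔤 is semi-simple, the
  only element invariant is 0, and we conclude ((δ/δ𝓗(b))𝒫′₁)(g₀, X, 1) = 0. (32) It is the only place we use the
  semi-simplicity, but the above conclusion is a fundamental point in our method. In the renormalization group language
  it is the statement that there are no relevant variables in the effective action."*
* p. 272 (render `…-p018`, after (63)): *"This gives an expansion for the sum above into gauge invariant, localized
  expressions, with proper exponential decay properties. These are analyzed further in the same way as the perturbative
  terms."* … *"By the above formula this gives an expansion of the last integral in (63) into a sum of gauge invariant,
  localized terms. They are again analyzed in the way described before."* … *"Now let us notice that gathering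
  together the first terms in the expansions (30) we obtain the expansion of (63) for the external field U_{k+1} = 1.
  This is cancelled by the second term in (61), and we obtain the desired expansion."* (last sentence added in v1.1,
  render `…-p018` re-read: the subtracted term of (61) — and of [II] p. 21's [log Z⁽ᵏ⁾(U_{k+1}) − log Z⁽ᵏ⁾(1)] — is the value
  AT THE FIXED POINT U_{k+1} = 1 of the global action, HONEST SCOPE (iv′)).

[Balaban1987RG1] = part I, Commun. Math. Phys. **109** (1987) 249–301.
* p. 262 (render `1987-cmp109-rg-I-small-field-p014`; added in v1.1): *"the configuration 𝐉 is also defined at bonds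
  of X and has values in 𝔤ᶜ. A Gᶜ-valued gauge transformation u acts on pairs (𝐔, 𝐉) in the following way
  (𝐔, 𝐉)ᵘ = (𝐔ᵘ, R(u)𝐉) = (u₋𝐔u₊⁻¹, R(u₋)𝐉), (1.10) where for a bond b = ⟨b₋, b₊⟩ we define u±(b) = u(b±)."*
* p. 263 (render `1987-cmp109-rg-I-small-field-p015`): *"We assume that the function 𝐄⁽ʲ⁾(X, g_{j−1}, 𝐔, 𝐉) is defined
  and analytic on the space Uᶜ_j(X, α₀, α₁), with some positive, absolute constants α₀, α₁"*; *"The most important is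
  gauge invariance. We assume that all functions 𝐄⁽ʲ⁾(X, g_{j−1}, 𝐔, 𝐉) are gauge invariant with respect to the group
  of all gauge transformations (1.10). Explicitly 𝐄⁽ʲ⁾(X, g_{j−1}, 𝐔ᵘ, R(u)𝐉) = 𝐄⁽ʲ⁾(X, g_{j−1}, 𝐔, 𝐉) (1.19) for all
  Gᶜ-valued gauge transformations u. The spaces Uᶜ_j(X, α₀, α₁) are, by the definition, gauge invariant also."*
* p. 283 (render `…-p035`): *"We assume the gauge invariance with respect to Gᶜ-valued gauge transformations, but it is
  implied by the invariance with respect to G-valued transformations, and by the analyticity of the function, as it was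
  noticed already."*
* p. 284 (render `…-p036`): *"For constant λ we get ⟨(δ/δB)𝐄(1), iad_λB₁⟩ = 0, and since the configuration B₁ is
  arbitrary, we get [λ, (δ/δB)𝐄(1)] = 0 for all λ ∈ 𝐠ᶜ. The group G is semisimple, hence this is possible only for the
  element 0 in the algebra 𝐠ᶜ. Thus we have the first, very important consequence of the gauge invariance
  (δ/δB)𝐄(1) = 0. (4.14)"* — kernel-certified abstractly in the tree module `B12Ward414` (b03 lineage), whose
  `fderiv_eq_zero_of_analytic_invariant` and `span_range_adConst_eq_top_of_isSemisimple` §2b / §3 invoke BY NAME.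

[Balaban1988RG2Cluster] (the paper under audit), p. 21 (render `1988-cmp116-rg-II-cluster-p021`; lineage transcript):
*"The effective action in (I.1.6) is obtained by adding to the above action the expression
[log Z⁽ᵏ⁾(U_{k+1}) − log Z⁽ᵏ⁾(1)]. For this expression we construct the representation (I.1.7) using the generalized random
walk expansion for Z⁽ᵏ⁾(U_{k+1}). The expansion was constructed in [16], see the formula (63) there, and the discussion
after it. We gather all terms in the expansions, localized in X, and we extend them to analytic functions of U, J. The
expression localized in X satisfies the bound (I.1.18) with κ replaced by δ₀M, and with an absolute constant instead of
E₀."*; p. 21, last paragraph (running on to p. 22): *"the expressions (2.14) are gauge invariant with respect to all G-valued transformations. The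
expressions are analytic functions of (U,J), hence the invariance can be extended, by the analyticity, to Gᶜ-valued gauge
transformations in a small neighborhood of the space of G-valued ones."* — continuing (pp. 21–22, renders
`…-p021`/`…-p022`, added in v1.1): *"This means that the expressions are constant on intersections of orbits with the
corresponding space of configurations (𝐔, 𝐉) satisfying the conditions I.(i)–(iv). We extend them to constant functions
on whole orbits having non-empty intersections with the space. The above remark completes the proof of the inductive
assumptions for the action A_{k+1}, hence the proof of Theorem I.3."*

## §1 What is certified (all statements are implications between hypotheses; no object of the papers is constructed)

* §1 `deriv_comp_eq_zero_of_fderiv_eq_zero` [folklore]: (32) ⇒ no first-order term along ANY line ζ ↦ γ(ζ) through the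
  unit configuration (γ(0) = 0 in the chart) differentiable at ζ = 0 — the chain rule.
* §2 the printed route of [Balaban1985UV3] p. 264, for a function g on a normed ℂ-space V (the chart) with values in a
  normed space, DIFFERENTIABLE AT 0 ONLY: `fderiv_comp_eq_of_invariant` = (26) ⇒ (31) (invariance under a continuous
  linear map T near 0 ⇒ Dg(0) ∘ T = Dg(0)); `apply_generator_eq_zero_of_comp_eq` = (31) differentiated along a
  one-parameter family T_t (d/dt T_t w = L w at t = 0) ⇒ ⟨Dg(0), L w⟩ = 0; `fderiv_eq_zero_of_linearInvariant(_ball)` =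
  (32): if the ranges of the generators L_λ span a dense subspace ("the only element invariant is 0"), Dg(0) = 0.
* §2b the route of [Balaban1987RG1] (4.9)–(4.14) for NON-LINEAR flows on the analyticity ball, by name from `B12Ward414`:
  `fderiv_eq_zero_of_flowInvariant`.
* §3 the Lie model of the detecting property with generators running over a family `lam : Λ → 𝔤ᶜ` that merely SPANS 𝔤ᶜ
  over ℂ (e.g. a real form 𝔤 ⊂ 𝔤ᶜ — *"R(U), U ∈ G"*, the compact group, suffices; [Balaban1987RG1] p. 283 *"it is
  implied by the invariance with respect to G-valued transformations"*): `span_range_adConst_le_of_span_eq_top`,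
  `dense_span_range_of_conj_adConst_of_span` (from `B12Ward414.span_range_adConst_eq_top_of_isSemisimple`).
* §3b (v1.2) the GENERATOR-LEVEL relative detecting statement in an associative ℂ-algebra 𝔸 with the commutator bracket
  (Mathlib `LieRing.ofAssociativeRing`, local instance): `lieSubalgebra_le_span_comm` (𝔥 ⊆ span_ℂ{lam l · y − y · lam l} for
  𝔥 a finite-dimensional semisimple Lie subalgebra ℂ-spanned by `lam`; from `B12Ward414.span_range_adConst_eq_top_of_isSemisimple`
  and `span_range_adConst_le_of_span_eq_top` with ONE variable, pushed along the inclusion 𝔥 ↪ 𝔸),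
  `mem_closure_span_comm_of_mem` (the per-bond binder `hcomm` of `B10Eq31GlobalConj` for 𝔥-valued generators),
  `one_not_mem_span_comm_complex` (negative control: in ℂ every commutator vanishes).
* §4 THE LEAF: `InChart` (the lines pass differentiably through the unit configuration inside a chart),
  `line_zero_eq_of_inChart` (v1.1, [folklore]: `InChart` pins the ζ = 0 end of every line to the chart centre `chart X 0`
  — ONE configuration per X, independent of the evaluation configuration φ; HONEST SCOPE (iv′)),
  `derivZeroAlongV_of_fderiv_chart` ((32) in the chart ⇒ (L3′)), `derivZeroAlongV_of_linearInvariant` ((26) for the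
  global group + detecting generators ⇒ (L3′)), `derivZeroAlongV_of_semisimple` (the Lie model supplies the detecting
  property).
* §5 COMPOSITION with `B10Eq61PerSite` v1.1: `bound118_secondOrder_of_linearInvariant` and
  `logHalfBound_secondOrder_twoRegime_of_linearInvariant` = the b10 theorems with `h0` replaced by the data (a)–(c).
* §6 NON-VACUITY: on V = ℂ × ℂ with the hyperbolic global symmetry T_t(a, b) = (eᵗa, e⁻ᵗb) (generator L(a, b) = (a, −b),
  surjective) the NON-CONSTANT invariant analytic function g(a, b) = a·b satisfies every hypothesis of §2 and Dg(0) = 0 —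
  invariants start at second order, which is the printed phenomenon; and the leaf (L3′) is obtained for the family
  `E X φ = φ.1·φ.2` along the lines `ζ ↦ ζ•φ` from `derivZeroAlongV_of_linearInvariant` with no hypothesis `False`.

## §2 Dictionary (print ↦ kernel)

configurations near the unit one, in the gauge of (29): `𝓗 ↦ exp i𝓗` (bonds → 𝔤ᶜ, together with the 𝐉-variables of
[Balaban1987RG1] on which R(u) acts by Ad) ↦ a normed ℂ-space `V` and a map `chart X : V → Φ` into the configuration type
`Φ` of `B10Eq61PerSite` with `chart X 0` the unit configuration; the localized piece `𝒫′₁(g₀, X, ·)` / a (63)-term /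
`𝐄⁽ʲ⁾(X, ·)` ↦ `E X : Φ → ℂ`, read in the chart as `g_X = E X ∘ chart X`; *"(δ/δ𝓗(b))𝒫′₁(g₀, X, 1)"* ↦ `fderiv ℂ g_X 0`;
the global transformations *"R(U), U ∈ G"* ↦ continuous linear maps `T l t : V →L[ℂ] V` (print: one-parameter
subgroups t ↦ exp tλ_l acting on every variable — by conjugation on 𝐔, by R(u) = Ad on 𝐉, (1.10) p. 262; kernel: any
one-parameter FAMILIES indexed by t — only the velocity at t = 0, hypothesis `hTd`, is ever used, never a group law,
cell GAPS C-adv2-66 R3) with generators `L l : V →L[ℂ] V` (= ad_{λ_l} on every variable: `B12Ward414.adConst`,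
hypothesis `hconj`); (26) ↦ `g_X (T l t v) = g_X v` on the analyticity ball; *"the only element
invariant is 0"* ↦ `Dense (span ℂ (⋃ l, range (L l)))`, supplied by semisimplicity in §3; the one-gauge line
`ζ ↦ exp iζη𝓗(B)` of `B10Eq61PerSite` ↦ `line X φ` with `InChart chart sp' line`.

## §3 HONEST SCOPE

(i) The module certifies the IMPLICATION (a) ∧ (b) ∧ (c) ⇒ (L3′); whether Bałaban's (63)-pieces in d = 4 satisfy (a) and
(b) individually is the printed-by-assertion content of [Balaban1985UV3] p. 272 (*"gauge invariant, localized
expressions … analyzed further in the same way as the perturbative terms"*) and of [Balaban1988RG2Cluster] p. 21 (*"we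
extend them to analytic functions of U, J"*) — recorded, not adjudicated here (cell GAPS G-B13-12 / G-B13-12a stay OPEN
on WHICH analyticity space the d = 4 pieces enjoy; this module is silent on radii).  (ii) Semisimplicity enters as
`LieAlgebra.IsSemisimple ℂ 𝔤` for the COMPLEX Lie algebra of the chart variables (for a compact semisimple G the
complexification 𝔤ᶜ is semisimple — classical, not re-derived).  (iii) The exponential chart presumes a logarithm of the
configuration on the dependence set — the gauge of (27)–(29) of [Balaban1985UV3] p. 263, fixed on a neighbourhood □₁ of
the localization cube, in which the configuration reads exp i𝓗(B) with 𝓗(B) small by (28) (paraphrase, not a quotation);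
the torus-winding caveat of `B13LogHalfRadius` (gen 14, C1) for domains wrapping the torus at the last scales is untouched.
(iv) The line need not be straight in the chart (`InChart` asks only differentiability at ζ = 0 through the unit
configuration), so 𝐉-components depending non-linearly on ζ are covered.  (iv′) (v1.1, cell GAPS C-adv2-66 R1) WHAT
`InChart` PINS: the ζ = 0 end of every line is the chart centre, `line X φ 0 = chart X 0` for all φ ∈ sp' X
(`line_zero_eq_of_inChart`) — the subtracted configuration of (61) / of [II] p. 21 is ONE point per X, independent of the
evaluation configuration φ, and route §2 uses the invariance (b) AT that point, so it must be a FIXED POINT of the global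
action: with the 𝐉-variables among the chart variables, acted on by R(u) = Ad ((1.10) p. 262), the fixed point is
(𝐔, 𝐉) = (1, 0).  Print is consistent with this reading: the subtracted term log Z⁽ᵏ⁾(1) of [II] p. 21 carries no 𝐉, and
B10's second term of (61) is the value at U_{k+1} = 1 (p. 272, quoted in §0).  A line moving 𝐔 alone at a fixed 𝐉 ≠ 0 is
NOT `InChart` for a chart centred at a fixed point, and the (32)-conclusion genuinely fails there — the 𝐔-derivative at
(1, 𝐉) is covariant under all of G but INVARIANT only under the stabiliser of 𝐉, whose ad-ranges do not span 𝔤 for 𝐉 ≠ 0 (v1.2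
wording, cell GAPS C-adv2-68); a global invariant of the type Σ_b ⟨𝓗(b), 𝐉(b)⟩ (Ad-invariant pairing) has the non-zero
first-order term 𝐉, so such configurations are outside this module's claim (the consumer
`B10Eq61Leaves` builds the φ-independent base point in: `expLine gen (fun X _ => base₀ X)`).  (v) Route §2 needs
g differentiable AT the unit configuration only and T linear; route §2b (non-linear flows) needs analyticity on a ball —
both are weaker than the printed standing assumptions.  (vi) No constant of the paper is computed here; §5 only
re-exports b10's constants `16A(1 + c₀²)/a²·c₁` at rate `r − 3` and `16A(1 + c₀²)/a² + 2A` at rate `r − 2`.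
(vii) (v1.1, cell GAPS C-B13-32 UPDATE (b10-g19)) ABSOLUTE vs RELATIVE DETECTING.  The hypothesis
`hspan : Dense (span ℂ (⋃ l, range (L l)))` asks the generators to detect the WHOLE chart space V — the right typing when
V is modelled on ι → 𝔤ᶜ itself (§3, `derivZeroAlongV_of_semisimple` with `e : V ≃ₗ[ℂ] (ι → 𝔤)`), and load-bearing
(pv27-g10 K4: dropping it, g = id on V = ℂ with no symmetries is a counterexample).  In a chart valued in a BIGGER
algebra — the C⋆-model of the b10 lineage, V = ι → 𝔸 with 𝔸 ⊋ 𝔤 (e.g. M_N(ℂ) ⊋ 𝔰𝔲(N)) — conjugation symmetries never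
detect the centre (kernel witness `B10Eq61Leaves.example_fderiv_apply_center`: E = tr, D(E ∘ expChart)(0)(1) = 2 ≠ 0),
and the print-faithful statement is the RELATIVE one: Dg(0) vanishes on the CLOSED SPAN of the generators' ranges,
which gives (L3′) as soon as the line's direction 𝓗(B) lies there (p. 264: *"The derivative in the above formula is an
element of the Lie algebra 𝔤"*; 𝓗(B) is 𝔤-valued by (27)) — proved FROM §2 of this module (`fderiv_comp_eq_of_invariant`,
`apply_generator_eq_zero_of_comp_eq`, then: the kernel of the continuous linear Dg(0) is closed) in the consumer
`B10Eq61Leaves.fderiv_apply_eq_zero_of_linearInvariant(_ball)_of_mem_closure` (b10-g19, gate p185047), deliberately NOT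
duplicated here; under density the relative form specialises back to `fderiv_eq_zero_of_linearInvariant`.
(v1.2) So `hspan` is the typing for 𝔤ᶜ-VALUED charts; for charts in a bigger algebra the relative form is used, and what it
needs at the GENERATOR level — per bond, the line's direction in the closed span of the commutators `[Y_l, y]`, the consumer's
binder `hcomm` (`B10Eq31GlobalConj.mem_closure_span_range_adCfg`, b10-g21, gate p185846) — is supplied HERE from semisimplicity by
§3b `lieSubalgebra_le_span_comm` for directions in a finite-dimensional semisimple Lie subalgebra 𝔥 ⊆ 𝔸 (the realised 𝔤ᶜ)
that the symmetry generators ℂ-span (a basis of the real form 𝔤 does: [Balaban1987RG1] p. 283).  Instance assumptions as in (ii):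
𝔤ᶜ complex semisimple, and 𝔤 ∩ i𝔤 = 0 inside the bond algebra (true in 𝔲(N)) so that 𝔤 ℂ-spans its complexification image.

Tags: [folklore] = calculus / linear algebra proved here from Mathlib; [cite: KEY, locus] = the typed shape of the quoted
sentence, proved here from hypotheses (never an axiom).  Bib keys: Balaban1985UV3, Balaban1987RG1, Balaban1988RG2Cluster.
-/
import Literature.MathematicalPhysics.QuantumFieldTheory.Balaban1983to89.B10Eq61PerSite
import Literature.MathematicalPhysics.QuantumFieldTheory.Balaban1983to89.B12Ward414

open Metric Set Filter
open scoped Topology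

namespace Literature.MathematicalPhysics.QuantumFieldTheory.Balaban1983to89.B13DerivZeroGauge

open B10Eq61PerSite (DerivZeroAlongV LineInStrip AnalyticOnStrip EndpointsIn below diffAlongV unitSys)
open B12Ward414 (adConst)

/-! ## §1 One function: the chain rule at the unit configuration -/

section chain

variable {V : Type*} [NormedAddCommGroup V] [NormedSpace ℂ V]

/-- **(32) ⇒ no first-order term along a line**: if `g` (the piece read in the chart) is differentiable at the unit
configuration `0` with `Dg(0) = 0`, then along ANY curve `γ` with `γ 0 = 0`, differentiable at `ζ = 0`, the composite
`ζ ↦ g (γ ζ)` has derivative `0` at `0`.  The chain rule. [folklore] -/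
theorem deriv_comp_eq_zero_of_fderiv_eq_zero {g : V → ℂ} {γ : ℂ → V} (hγ0 : γ 0 = 0)
    (hγ : DifferentiableAt ℂ γ 0) (hg : DifferentiableAt ℂ g 0) (h32 : fderiv ℂ g 0 = 0) :
    deriv (fun ζ => g (γ ζ)) 0 = 0 := by
  have h1 : HasFDerivAt g (fderiv ℂ g 0) (γ 0) := by
    rw [hγ0]; exact hg.hasFDerivAt
  have h2 : HasDerivAt (fun ζ => g (γ ζ)) (fderiv ℂ g 0 (deriv γ 0)) 0 :=
    h1.comp_hasDerivAt 0 hγ.hasDerivAt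
  rw [h2.deriv, h32]
  simp

/-- The same for a function `f` that AGREES near `ζ = 0` with such a composite (the line of `B10Eq61PerSite` is a map
into an abstract configuration type; only its germ at `0` read in the chart matters). [folklore] -/
theorem deriv_eq_zero_of_eventuallyEq_comp {f : ℂ → ℂ} {g : V → ℂ} {γ : ℂ → V}
    (hf : f =ᶠ[𝓝 0] fun ζ => g (γ ζ)) (hγ0 : γ 0 = 0) (hγ : DifferentiableAt ℂ γ 0)
    (hg : DifferentiableAt ℂ g 0) (h32 : fderiv ℂ g 0 = 0) : deriv f 0 = 0 := by
  rw [hf.deriv_eq]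
  exact deriv_comp_eq_zero_of_fderiv_eq_zero hγ0 hγ hg h32

end chain

/-! ## §2 (26) ⇒ (31) ⇒ (32): the route of [Balaban1985UV3] p. 264 (linear global symmetry, differentiability at 0) -/

section ward31

variable {V : Type*} [NormedAddCommGroup V] [NormedSpace ℂ V] {F : Type*} [NormedAddCommGroup F]
  [NormedSpace ℂ F]

/-- **(26) ⇒ (31)**: *"The gauge invariance (26) implies the invariance with respect to the global transformations
R(U), U ∈ G, hence the equality R(U)((δ/δ𝓗(b))𝒫′₁)(g₀, X, 1) = ((δ/δ𝓗(b))𝒫′₁)(g₀, X, 1). (31)"* — if `g` is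
differentiable at `0` and invariant near `0` under a continuous linear map `T` (which fixes `0`), then
`Dg(0) ∘ T = Dg(0)`. [cite: Balaban1985UV3, (26), (31) pp.263–264] -/
theorem fderiv_comp_eq_of_invariant {g : V → F} (T : V →L[ℂ] V) (hg : DifferentiableAt ℂ g 0)
    (hinv : ∀ᶠ v in 𝓝 (0 : V), g (T v) = g v) : (fderiv ℂ g 0).comp T = fderiv ℂ g 0 := by
  have hg' : HasFDerivAt g (fderiv ℂ g 0) (T 0) := by
    rw [map_zero]; exact hg.hasFDerivAt
  have h1 : HasFDerivAt (fun v => g (T v)) ((fderiv ℂ g 0).comp T) 0 := hg'.comp 0 T.hasFDerivAt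
  have h2 : fderiv ℂ (fun v => g (T v)) 0 = fderiv ℂ g 0 := Filter.EventuallyEq.fderiv_eq hinv
  exact h1.fderiv.symm.trans h2

/-- **(31), differentiated along a one-parameter subgroup**: *"We have to notice only that (26) holds for all regular
gauge field configurations … The derivative in the above formula is an element of the Lie algebra 𝔤"* on which R(U)
acts — if a covector `φ` (= Dg(0)) satisfies `φ (T_t w) = φ w` for `t` near `0`, where `t ↦ T_t w` has velocity
`L w` at `t = 0`, then `φ (L w) = 0` (`T₀ = id` is not even needed). [cite: Balaban1985UV3, (31) p.264] -/
theorem apply_generator_eq_zero_of_comp_eq (φ : V →L[ℂ] F) {T : ℝ → V → V} {L : V → V} {w : V}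
    (hTd : HasDerivAt (fun t => T t w) (L w) 0)
    (h31 : ∀ᶠ t in 𝓝 (0 : ℝ), φ (T t w) = φ w) : φ (L w) = 0 := by
  have h1 : HasDerivAt (fun t => φ (T t w)) (φ (L w)) 0 := by
    have h := (φ.restrictScalars ℝ).hasFDerivAt.comp_hasDerivAt (0 : ℝ) hTd
    simpa [Function.comp_def] using h
  have h2 : HasDerivAt (fun t => φ (T t w)) 0 0 := by
    have hc : (fun t => φ (T t w)) =ᶠ[𝓝 (0 : ℝ)] fun _ => φ w := by
      filter_upwards [h31] with t ht using ht
    exact (hasDerivAt_const (0 : ℝ) (φ w)).congr_of_eventuallyEq hc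
  exact h1.unique h2

/-- Invariance on the analyticity ball (*"(26) holds for all regular gauge field configurations"*) gives invariance
near `0` under each continuous linear `T`: the configurations `v` with `v` and `T v` in the ball form a neighbourhood of
`0`. [folklore] -/
theorem eventually_invariant_of_ball {W : Type*} {g : V → W} {α : ℝ} (hα : 0 < α) (T : V →L[ℂ] V)
    (hinv : ∀ v ∈ ball (0 : V) α, T v ∈ ball (0 : V) α → g (T v) = g v) :
    ∀ᶠ v in 𝓝 (0 : V), g (T v) = g v := by
  have h1 : ∀ᶠ v in 𝓝 (0 : V), v ∈ ball (0 : V) α := ball_mem_nhds 0 hα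
  have h2 : ∀ᶠ v in 𝓝 (0 : V), T v ∈ ball (0 : V) α := by
    have hT : Tendsto T (𝓝 0) (𝓝 (T 0)) := T.continuous.tendsto 0
    rw [map_zero] at hT
    exact hT.eventually (ball_mem_nhds (0 : V) hα)
  filter_upwards [h1, h2] with v hv hTv using hinv v hv hTv

/-- **(26) ⇒ (32)** [Balaban1985UV3 route]: *"by the assumption that 𝔤 is semi-simple, the only element invariant is
0, and we conclude ((δ/δ𝓗(b))𝒫′₁)(g₀, X, 1) = 0. (32)"* — `g` differentiable at `0`; a family of one-parameter FAMILIES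
of continuous linear maps `T l t` (velocity `L l w` at `t = 0` on every vector `w`; only this velocity is used, no group
law — print's one-parameter subgroups of the R(U) are the model, v1.1/R3) leaving `g` invariant near `0`; the ranges of
the generators `L l` spanning a dense subspace (the ABSOLUTE detecting property, = semisimplicity in the Lie model of §3
for a 𝔤ᶜ-valued chart; for charts valued in a bigger algebra see the RELATIVE form, HONEST SCOPE (vii)) ⟹ `Dg(0) = 0`.
[cite: Balaban1985UV3, (31)–(32) p.264] -/
theorem fderiv_eq_zero_of_linearInvariant {Λ : Type*} {g : V → F} (T : Λ → ℝ → V →L[ℂ] V)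
    (L : Λ → V →L[ℂ] V) (hg : DifferentiableAt ℂ g 0)
    (hTd : ∀ l w, HasDerivAt (fun t => T l t w) (L l w) 0)
    (hinv : ∀ l t, ∀ᶠ v in 𝓝 (0 : V), g (T l t v) = g v)
    (hspan : Dense (Submodule.span ℂ (⋃ l, Set.range (L l)) : Set V)) : fderiv ℂ g 0 = 0 := by
  refine ContinuousLinearMap.ext_on hspan fun v hv => ?_
  obtain ⟨l, w, rfl⟩ : ∃ l w, L l w = v := by
    rcases Set.mem_iUnion.1 hv with ⟨l, w, hw⟩
    exact ⟨l, w, hw⟩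
  have h31 : ∀ᶠ t in 𝓝 (0 : ℝ), fderiv ℂ g 0 (T l t w) = fderiv ℂ g 0 w := by
    refine Filter.Eventually.of_forall fun t => ?_
    have h := congrArg (fun S : V →L[ℂ] F => S w) (fderiv_comp_eq_of_invariant (T l t) hg (hinv l t))
    simpa using h
  have h := apply_generator_eq_zero_of_comp_eq (fderiv ℂ g 0) (T := fun t => (T l t : V → V))
    (L := fun w => L l w) (hTd l w) h31
  simpa using h

/-- **(26) ⇒ (32) with the invariance stated on the analyticity ball** of radius `α` around the unit configuration
(the printed *"for all regular gauge field configurations"*). [cite: Balaban1985UV3, (26), (31)–(32) pp.263–264] -/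
theorem fderiv_eq_zero_of_linearInvariant_ball {Λ : Type*} {g : V → F} {α : ℝ} (hα : 0 < α)
    (T : Λ → ℝ → V →L[ℂ] V) (L : Λ → V →L[ℂ] V) (hg : DifferentiableAt ℂ g 0)
    (hTd : ∀ l w, HasDerivAt (fun t => T l t w) (L l w) 0)
    (hinv : ∀ l t, ∀ v ∈ ball (0 : V) α, T l t v ∈ ball (0 : V) α → g (T l t v) = g v)
    (hspan : Dense (Submodule.span ℂ (⋃ l, Set.range (L l)) : Set V)) : fderiv ℂ g 0 = 0 :=
  fderiv_eq_zero_of_linearInvariant T L hg hTd (fun l t => eventually_invariant_of_ball hα (T l t) (hinv l t))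
    hspan

end ward31

/-! ## §2b The route of [Balaban1987RG1] (4.9)–(4.14) for non-linear flows, by name from `B12Ward414` -/

section ward414

variable {V : Type*} [NormedAddCommGroup V] [NormedSpace ℂ V] {F : Type*} [NormedAddCommGroup F]
  [NormedSpace ℂ F] [CompleteSpace F]

/-- **(4.7) ⇒ (4.9) ⇒ (4.14) for flows**: `g` analytic on the ball of radius `α`; flows `R l t : V → V` (not
necessarily linear: Gᶜ-valued or configuration-dependent transformations read in the chart) with `R l 0 = id` and
velocity field `L l` (continuous linear) at `t = 0`; `g` invariant under each flow on the ball; detecting generators ⟹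
`Dg(0) = 0` — `B12Ward414.fderiv_apply_eq_zero_of_const_along_real` gives (4.9) at every point of the ball and
`B12Ward414.fderiv_eq_zero_of_analytic_invariant` gives (4.14). [cite: Balaban1987RG1, (4.7)–(4.14) pp.282–284] -/
theorem fderiv_eq_zero_of_flowInvariant {Λ : Type*} {g : V → F} {α : ℝ} (hα : 0 < α)
    (hg : AnalyticOnNhd ℂ g (ball 0 α)) (R : Λ → ℝ → V → V) (L : Λ → V →L[ℂ] V)
    (hR0 : ∀ l v, R l 0 v = v) (hRd : ∀ l v, HasDerivAt (fun t => R l t v) (L l v) 0)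
    (hinv : ∀ l t, ∀ v ∈ ball (0 : V) α, R l t v ∈ ball (0 : V) α → g (R l t v) = g v)
    (hspan : Dense (Submodule.span ℂ (⋃ l, Set.range (L l)) : Set V)) : fderiv ℂ g 0 = 0 := by
  refine B12Ward414.fderiv_eq_zero_of_analytic_invariant hα hg L (fun l v hv => ?_) hspan
  have hcont : ContinuousAt (fun t => R l t v) 0 := (hRd l v).continuousAt
  have hmem : ∀ᶠ t in 𝓝 (0 : ℝ), R l t v ∈ ball (0 : V) α := by
    have h : Tendsto (fun t => R l t v) (𝓝 0) (𝓝 (R l 0 v)) := hcont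
    rw [hR0] at h
    exact h.eventually (isOpen_ball.mem_nhds hv)
  have hconst : ∀ᶠ t in 𝓝 (0 : ℝ), g (R l t v) = g v := by
    filter_upwards [hmem] with t ht using hinv l t v hv ht
  exact B12Ward414.fderiv_apply_eq_zero_of_const_along_real (hR0 l v) (hRd l v) (hg v hv).differentiableAt hconst

end ward414

/-! ## §3 The Lie model of the detecting property with generators that only SPAN 𝔤ᶜ (e.g. a real form: U ∈ G) -/

section Lie

/-- If a family `lam : Λ → 𝔤` spans the Lie algebra (over the scalars `K`), the ranges of the `ad_{lam l}` acting
variable-wise (`adConst`) span as much as the ranges of ALL `ad_x`, `x ∈ 𝔤`: `ad` is linear in its first argument.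
(For `K = ℂ`, `𝔤 = 𝐠ᶜ` and `lam` the inclusion of a basis of the REAL algebra 𝐠 this is [Balaban1987RG1] p. 283 *"it is
implied by the invariance with respect to G-valued transformations"* at the level of generators.) [folklore] -/
theorem span_range_adConst_le_of_span_eq_top {K : Type*} [Field K] {𝔤 : Type*} [LieRing 𝔤] [LieAlgebra K 𝔤]
    {ι : Type*} {Λ : Type*} (lam : Λ → 𝔤) (hlam : Submodule.span K (Set.range lam) = ⊤) :
    Submodule.span K (⋃ x : 𝔤, Set.range (adConst (K := K) (ι := ι) x)) ≤
      Submodule.span K (⋃ l : Λ, Set.range (adConst (K := K) (ι := ι) (lam l))) := by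
  rw [Submodule.span_le]
  intro B hB
  rcases Set.mem_iUnion.1 hB with ⟨x, w, rfl⟩
  clear hB
  change adConst (K := K) (ι := ι) x w ∈
    Submodule.span K (⋃ l : Λ, Set.range (adConst (K := K) (ι := ι) (lam l)))
  have hx : x ∈ Submodule.span K (Set.range lam) := by rw [hlam]; exact Submodule.mem_top
  induction hx using Submodule.span_induction with
  | mem y hy =>
      obtain ⟨l, rfl⟩ := hy
      exact Submodule.subset_span (Set.mem_iUnion.2 ⟨l, w, rfl⟩)
  | zero =>
      have h0 : adConst (K := K) (ι := ι) (0 : 𝔤) w = 0 := by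
        funext i; simp
      rw [h0]; exact Submodule.zero_mem _
  | add y z _ _ hy hz =>
      have hadd : adConst (K := K) (ι := ι) (y + z) w = adConst (K := K) y w + adConst (K := K) z w := by
        funext i; simp
      rw [hadd]; exact Submodule.add_mem _ hy hz
  | smul c y _ hy =>
      have hsmul : adConst (K := K) (ι := ι) (c • y) w = c • adConst (K := K) y w := by
        funext i; simp
      rw [hsmul]; exact Submodule.smul_mem _ c hy

/-- **The detecting property from semisimplicity, generators over a SPANNING family**: V a normed space over a normed
field 𝕜 of characteristic 0 (𝕜 = ℂ), 𝔤 a finite-dimensional semisimple Lie algebra over 𝕜 (= 𝐠ᶜ), ι a finite index set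
of variables (bonds, and the 𝐉-variables), `e : V ≃ₗ[𝕜] (ι → 𝔤)` any linear identification conjugating the generators
`L l` to `ad_{lam l}` variable-wise, where `lam : Λ → 𝔤` SPANS 𝔤 over 𝕜 ⟹ the ranges of the `L l` span a dense subspace
of V.  `B12Ward414.dense_span_range_of_conj_adConst_of_isSemisimple` is the case `lam` surjective.
[cite: Balaban1985UV3, (31)–(32) p.264; Balaban1987RG1, (4.13)–(4.14) p.284] -/
theorem dense_span_range_of_conj_adConst_of_span {𝕜 : Type*} [NontriviallyNormedField 𝕜] [CharZero 𝕜]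
    {V : Type*} [NormedAddCommGroup V] [NormedSpace 𝕜 V] {𝔤 : Type*} [LieRing 𝔤] [LieAlgebra 𝕜 𝔤]
    [FiniteDimensional 𝕜 𝔤] [LieAlgebra.IsSemisimple 𝕜 𝔤] {ι : Type*} [Fintype ι] [DecidableEq ι]
    (e : V ≃ₗ[𝕜] (ι → 𝔤)) {Λ : Type*} (lam : Λ → 𝔤) (hlam : Submodule.span 𝕜 (Set.range lam) = ⊤)
    (L : Λ → V →L[𝕜] V) (hconj : ∀ l v, e (L l v) = adConst (K := 𝕜) (lam l) (e v)) :
    Dense (Submodule.span 𝕜 (⋃ l, Set.range (L l)) : Set V) := by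
  have htop' : Submodule.span 𝕜 (⋃ l : Λ, Set.range (adConst (K := 𝕜) (ι := ι) (lam l))) = ⊤ := by
    apply top_le_iff.1
    rw [← B12Ward414.span_range_adConst_eq_top_of_isSemisimple (K := 𝕜) (𝔤 := 𝔤) (ι := ι)]
    exact span_range_adConst_le_of_span_eq_top lam hlam
  have htop : Submodule.span 𝕜 (⋃ l, Set.range ((L l : V →ₗ[𝕜] V))) = ⊤ :=
    B12Ward414.span_range_eq_top_of_conj e (fun l => (L l : V →ₗ[𝕜] V)) (fun l => adConst (K := 𝕜) (lam l))
      (fun l v => hconj l v) htop'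
  have hset : (Submodule.span 𝕜 (⋃ l, Set.range (L l)) : Set V) = Set.univ := by
    have : Submodule.span 𝕜 (⋃ l, Set.range (L l)) = ⊤ := by
      simpa only [ContinuousLinearMap.coe_coe] using htop
    rw [this]
    rfl
  rw [hset]
  exact dense_univ

end Lie

/-! ## §3b (v1.2) Lie subalgebras of an associative ℂ-algebra: the detected commutator span at the GENERATOR level -/

section LieSub

-- Mathlib idiom (Mathlib/Algebra/Lie/OfAssociative.lean): the commutator bracket `⁅a, b⁆ = a * b - b * a` on a ring.
attribute [local instance 100] LieRing.ofAssociativeRing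
attribute [local instance 100] LieAlgebra.ofAssociativeAlgebra

variable {𝔸 : Type*} [Ring 𝔸] [Algebra ℂ 𝔸]

/-- **The detected commutator span contains every semisimple Lie subalgebra spanned by the generators.**  In a ring 𝔸
that is a ℂ-algebra, with the commutator bracket, let `𝔥` be a finite-dimensional SEMISIMPLE Lie subalgebra (the realised
𝔤ᶜ inside the bond algebra, e.g. 𝔰𝔩_N ⊂ M_N(ℂ)) and `lam : Λ → 𝔥` a family that SPANS 𝔥 over ℂ (e.g. a basis of the real
form 𝔤 — *"R(U), U ∈ G"*).  Then every `z ∈ 𝔥` lies in `span_ℂ {lam l · y − y · lam l : l, y ∈ 𝔸}` — the typed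
*"[𝔤, 𝔸] ⊇ [𝔤ᶜ, 𝔤ᶜ] = 𝔤ᶜ"*: the element *"of the Lie algebra 𝔤"* of (32) is detected by the global transformations with
values in the compact group.  Proof: `B12Ward414.span_range_adConst_eq_top_of_isSemisimple` (Cartan's criterion) and
`span_range_adConst_le_of_span_eq_top` with ONE variable (`ι := Unit`), pushed into 𝔸 along the inclusion.
[cite: Balaban1985UV3, (31)–(32) p.264; Balaban1987RG1, p.283] -/
theorem lieSubalgebra_le_span_comm (𝔥 : LieSubalgebra ℂ 𝔸) [FiniteDimensional ℂ 𝔥]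
    [LieAlgebra.IsSemisimple ℂ 𝔥] {Λ : Type*} (lam : Λ → 𝔥)
    (hlam : Submodule.span ℂ (Set.range lam) = ⊤) {z : 𝔸} (hz : z ∈ 𝔥) :
    z ∈ Submodule.span ℂ {c : 𝔸 | ∃ l y, c = (lam l : 𝔸) * y - y * (lam l : 𝔸)} := by
  classical
  have htop : Submodule.span ℂ
      (⋃ l : Λ, Set.range (B12Ward414.adConst (K := ℂ) (ι := Unit) (lam l))) = ⊤ := by
    apply top_le_iff.1
    rw [← B12Ward414.span_range_adConst_eq_top_of_isSemisimple (K := ℂ) (𝔤 := 𝔥) (ι := Unit)]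
    exact span_range_adConst_le_of_span_eq_top lam hlam
  let f : (Unit → 𝔥) →ₗ[ℂ] 𝔸 :=
    { toFun := fun w => (w () : 𝔸)
      map_add' := fun v w => by simp
      map_smul' := fun c w => by simp }
  have hf : ∀ w : Unit → 𝔥, f w = (w () : 𝔸) := fun w => rfl
  have hmem : (fun _ : Unit => (⟨z, hz⟩ : 𝔥)) ∈ Submodule.span ℂ
      (⋃ l : Λ, Set.range (B12Ward414.adConst (K := ℂ) (ι := Unit) (lam l))) := by
    rw [htop]; exact Submodule.mem_top
  have himg : f (fun _ : Unit => (⟨z, hz⟩ : 𝔥)) ∈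
      Submodule.span ℂ (f '' ⋃ l : Λ, Set.range (B12Ward414.adConst (K := ℂ) (ι := Unit) (lam l))) := by
    rw [← Submodule.map_span]
    exact Submodule.mem_map_of_mem hmem
  have hz' : f (fun _ : Unit => (⟨z, hz⟩ : 𝔥)) = z := rfl
  rw [hz'] at himg
  refine Submodule.span_mono ?_ himg
  rintro _ ⟨w, hw, rfl⟩
  rcases Set.mem_iUnion.1 hw with ⟨l, v, rfl⟩
  refine ⟨l, (v () : 𝔸), ?_⟩
  rw [hf, B12Ward414.adConst_apply, LieSubalgebra.coe_bracket, Ring.lie_def]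

/-- **Configuration-level corollary** — the per-bond binder of the consumer's relative route
(`B10Eq31GlobalConj.mem_closure_span_range_adCfg`, hypothesis `hcomm`): generators `gen X φ b` valued in `𝔥` lie, bond by
bond, in the closed span of the commutators with the symmetry family (closure superfluous, kept for the consumer's shape;
any topology on 𝔸). [folklore] -/
theorem mem_closure_span_comm_of_mem [TopologicalSpace 𝔸] (𝔥 : LieSubalgebra ℂ 𝔸) [FiniteDimensional ℂ 𝔥]
    [LieAlgebra.IsSemisimple ℂ 𝔥] {Λ : Type*} (lam : Λ → 𝔥)
    (hlam : Submodule.span ℂ (Set.range lam) = ⊤)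
    {Dom Φ ι : Type*} (sp' : Dom → Set Φ) (gen : Dom → Φ → ι → 𝔸)
    (hgen : ∀ X φ, φ ∈ sp' X → ∀ b, gen X φ b ∈ 𝔥) :
    ∀ X φ, φ ∈ sp' X → ∀ b, gen X φ b ∈
      closure (Submodule.span ℂ {c : 𝔸 | ∃ l y, c = (lam l : 𝔸) * y - y * (lam l : 𝔸)} : Set 𝔸) :=
  fun X φ hφ b => subset_closure (lieSubalgebra_le_span_comm 𝔥 lam hlam (hgen X φ hφ b))

/-- **Negative control** — semisimplicity is load-bearing (*"It is the only place we use the semi-simplicity"*,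
[Balaban1985UV3] p. 264; the abelian U(1) is excluded by the paper): in the commutative algebra ℂ = 𝔲(1)ᶜ every
commutator vanishes and the unit is NOT detected. [folklore] -/
theorem one_not_mem_span_comm_complex :
    (1 : ℂ) ∉ Submodule.span ℂ {c : ℂ | ∃ (_ : Unit) (y : ℂ), c = (1 : ℂ) * y - y * 1} := by
  have hset : {c : ℂ | ∃ (_ : Unit) (y : ℂ), c = (1 : ℂ) * y - y * 1} = {0} := by
    ext c
    simp
  rw [hset, Submodule.span_zero_singleton]
  simp

end LieSub

/-! ## §4 The leaf (L3′) of `B10Eq61PerSite` from (a) differentiability, (b) global invariance, (c) detecting generators -/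

section leaf

variable {D : LocDomainSys} {Φ : Type*} {V : Type*} [NormedAddCommGroup V] [NormedSpace ℂ V]
  {sp' : D.Dom → Set Φ} {E : D.Dom → Φ → ℂ} {line : D.Dom → Φ → ℂ → Φ}

/-- **The lines pass differentiably through the unit configuration inside the chart**: for every localization domain
`X` and evaluation configuration `φ`, near `ζ = 0` the line `ζ ↦ line X φ ζ` reads `chart X (γ ζ)` for a curve `γ` in
the chart space `V` with `γ 0 = 0` (the unit configuration) differentiable at `0` — e.g. the straight line
`ζ ↦ ζ • 𝓗` of (29)–(30), `inChart_of_smul`; 𝐉-components depending non-linearly on ζ are allowed.  It PINS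
`line X φ 0 = chart X 0` (`line_zero_eq_of_inChart`, v1.1): the chart centre is one configuration per X, independent of
φ — the fixed point of the global action (HONEST SCOPE (iv′)).  Hypothesis shape.
[cite: Balaban1985UV3, (29)–(30) p.263] -/
def InChart (chart : D.Dom → V → Φ) (sp' : D.Dom → Set Φ) (line : D.Dom → Φ → ℂ → Φ) : Prop :=
  ∀ X φ, φ ∈ sp' X → ∃ γ : ℂ → V, γ 0 = 0 ∧ DifferentiableAt ℂ γ 0 ∧
    (fun ζ => line X φ ζ) =ᶠ[𝓝 (0 : ℂ)] fun ζ => chart X (γ ζ)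

/-- The straight lines of (29)–(30): `line X φ ζ = chart X (ζ • H X φ)` for all ζ ⟹ `InChart`. [folklore] -/
theorem inChart_of_smul (chart : D.Dom → V → Φ) (H : D.Dom → Φ → V)
    (hline : ∀ X φ, φ ∈ sp' X → ∀ ζ : ℂ, line X φ ζ = chart X (ζ • H X φ)) : InChart chart sp' line := by
  intro X φ hφ
  refine ⟨fun ζ => ζ • H X φ, by simp, (differentiableAt_id.smul_const (H X φ)), ?_⟩
  exact Filter.Eventually.of_forall fun ζ => hline X φ hφ ζ

/-- **What `InChart` pins** (added in v1.1): the ζ = 0 end of every line is the chart centre — `line X φ 0 = chart X 0`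
for every evaluation configuration `φ ∈ sp' X`; so the subtracted configuration is ONE point per X, independent of φ
(the fixed point of the global action: `U_{k+1} = 1`, for [II] `(𝐔, 𝐉) = (1, 0)`; HONEST SCOPE (iv′), cell GAPS
C-adv2-66 R1).  A germ at `ζ = 0` determines the value at `0`. [folklore] -/
theorem line_zero_eq_of_inChart {chart : D.Dom → V → Φ} (hch : InChart chart sp' line) {X : D.Dom} {φ : Φ}
    (hφ : φ ∈ sp' X) : line X φ 0 = chart X 0 := by
  obtain ⟨γ, hγ0, -, hEq⟩ := hch X φ hφ
  have h : line X φ 0 = chart X (γ 0) := hEq.eq_of_nhds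
  rwa [hγ0] at h

/-- **(32) in the chart ⇒ (L3′)**: if every piece read in the chart, `g_X = E X ∘ chart X`, is differentiable at the
unit configuration with `Dg_X(0) = 0`, the first derivative of `ζ ↦ E X (line X φ ζ)` at `ζ = 0` vanishes for every
evaluation configuration — the leaf `B10Eq61PerSite.DerivZeroAlongV sp' E line`. [cite: Balaban1985UV3, (30), (32) pp.263–264] -/
theorem derivZeroAlongV_of_fderiv_chart (chart : D.Dom → V → Φ) (hch : InChart chart sp' line)
    (hdiff : ∀ X, DifferentiableAt ℂ (fun v => E X (chart X v)) 0)
    (h32 : ∀ X, fderiv ℂ (fun v => E X (chart X v)) 0 = 0) : DerivZeroAlongV sp' E line := by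
  intro X φ hφ
  obtain ⟨γ, hγ0, hγd, hEq⟩ := hch X φ hφ
  have hf : (fun ζ => E X (line X φ ζ)) =ᶠ[𝓝 (0 : ℂ)] fun ζ => (fun v => E X (chart X v)) (γ ζ) := by
    filter_upwards [hEq] with ζ hζ using by simp only [hζ]
  exact deriv_eq_zero_of_eventuallyEq_comp (g := fun v => E X (chart X v)) (γ := γ) hf hγ0 hγd (hdiff X) (h32 X)

/-- **(26) + detecting generators ⇒ (L3′)** — the printed two lines of p. 264 for every localized piece: each
`g_X = E X ∘ chart X` differentiable at the unit configuration (a), invariant on a ball of radius `α X > 0` under the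
one-parameter families `T l t` (velocity `L l` at `t = 0`; only the velocity is used, v1.1/R3) of the global gauge group
acting linearly in the chart (b), whose generators `L l` have ranges spanning a dense subspace (c) — the ABSOLUTE
detecting property, for a 𝔤ᶜ-valued chart; relative form for bigger charts: HONEST SCOPE (vii) — ⟹
`DerivZeroAlongV sp' E line`. [cite: Balaban1985UV3, (26), (31)–(32) pp.263–264; p.272 (after (63))] -/
theorem derivZeroAlongV_of_linearInvariant {Λ : Type*} (chart : D.Dom → V → Φ) (hch : InChart chart sp' line)
    (T : Λ → ℝ → V →L[ℂ] V) (L : Λ → V →L[ℂ] V) (α : D.Dom → ℝ) (hα : ∀ X, 0 < α X)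
    (hdiff : ∀ X, DifferentiableAt ℂ (fun v => E X (chart X v)) 0)
    (hTd : ∀ l w, HasDerivAt (fun t => T l t w) (L l w) 0)
    (hinv : ∀ X l t, ∀ v ∈ ball (0 : V) (α X), T l t v ∈ ball (0 : V) (α X) →
      E X (chart X (T l t v)) = E X (chart X v))
    (hspan : Dense (Submodule.span ℂ (⋃ l, Set.range (L l)) : Set V)) : DerivZeroAlongV sp' E line :=
  derivZeroAlongV_of_fderiv_chart chart hch hdiff fun X =>
    fderiv_eq_zero_of_linearInvariant_ball (hα X) T L (hdiff X) hTd (hinv X) hspan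

/-- **(26) + semisimplicity ⇒ (L3′)**, the detecting property supplied by the Lie model of §3: the chart space is
identified (`e`, any ℂ-linear identification) with `ι → 𝔤`, 𝔤 a finite-dimensional semisimple Lie algebra over ℂ, the
generators act as `ad_{lam l}` on every variable, and the `lam l` span 𝔤 (*"R(U), U ∈ G"*: a real form suffices).
[cite: Balaban1985UV3, (31)–(32) p.264; Balaban1987RG1, (1.19) p.263, (4.14) p.284] -/
theorem derivZeroAlongV_of_semisimple {Λ : Type*} {𝔤 : Type*} [LieRing 𝔤] [LieAlgebra ℂ 𝔤]
    [FiniteDimensional ℂ 𝔤] [LieAlgebra.IsSemisimple ℂ 𝔤] {ι : Type*} [Fintype ι] [DecidableEq ι]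
    (chart : D.Dom → V → Φ) (hch : InChart chart sp' line) (T : Λ → ℝ → V →L[ℂ] V) (L : Λ → V →L[ℂ] V)
    (α : D.Dom → ℝ) (hα : ∀ X, 0 < α X) (hdiff : ∀ X, DifferentiableAt ℂ (fun v => E X (chart X v)) 0)
    (hTd : ∀ l w, HasDerivAt (fun t => T l t w) (L l w) 0)
    (hinv : ∀ X l t, ∀ v ∈ ball (0 : V) (α X), T l t v ∈ ball (0 : V) (α X) →
      E X (chart X (T l t v)) = E X (chart X v))
    (e : V ≃ₗ[ℂ] (ι → 𝔤)) (lam : Λ → 𝔤) (hlam : Submodule.span ℂ (Set.range lam) = ⊤)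
    (hconj : ∀ l v, e (L l v) = adConst (K := ℂ) (lam l) (e v)) : DerivZeroAlongV sp' E line :=
  derivZeroAlongV_of_linearInvariant chart hch T L α hα hdiff hTd hinv
    (dense_span_range_of_conj_adConst_of_span e lam hlam L hconj)

end leaf

/-! ## §5 Composition with `B10Eq61PerSite` v1.1: the second-order theorems with `h0` discharged -/

section composition

variable {D : LocDomainSys} {Φ : Type*} {V : Type*} [NormedAddCommGroup V] [NormedSpace ℂ V] {Λ : Type*}
  {sp sp' : D.Dom → Set Φ} {E : D.Dom → Φ → ℂ} {line : D.Dom → Φ → ℂ → Φ} {nX : D.Dom → ℕ} {h : D.Dom → ℝ}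

/-- **`B10Eq61PerSite.bound118_secondOrder_of_R21` with the leaf (L3′) replaced by (a) differentiability at the unit
configuration, (b) global gauge invariance, (c) detecting generators** — (I.1.18) for the differenced pieces with the
L, M-independent constant `(16A(1 + c₀²)/a²)·c₁` at rate `r − 3`; all other hypotheses exactly b10's (the leaves (L1′),
(L2′), the half-width shape, the undifferenced bound, the volume bound).
[cite: Balaban1988RG2Cluster, p.21 (closing paragraph); Balaban1985UV3, (31)–(32) p.264] -/
theorem bound118_secondOrder_of_linearInvariant (c : B13.Consts) (h21 : c.R21) (hLM : 1 ≤ (c.L : ℝ) * c.M)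
    (hα₀ : 0 ≤ c.α₀) (hα₁ : 0 ≤ c.α₁) {A a c₀ r c₁ : ℝ} (hA : 0 ≤ A)
    (hh : ∀ X, 0 < h X) (hH : ∀ X, (h X)⁻¹ ≤ (c.α₁ + c₀ * ((c.L : ℝ) * c.M) * c.α₀) / a * (1 + D.dj X))
    (hdom : LineInStrip sp' sp line h) (han : AnalyticOnStrip sp' E line h)
    (chart : D.Dom → V → Φ) (hch : InChart chart sp' line) (T : Λ → ℝ → V →L[ℂ] V) (L : Λ → V →L[ℂ] V)
    (α : D.Dom → ℝ) (hα : ∀ X, 0 < α X) (hdiff : ∀ X, DifferentiableAt ℂ (fun v => E X (chart X v)) 0)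
    (hTd : ∀ l w, HasDerivAt (fun t => T l t w) (L l w) 0)
    (hinv : ∀ X l t, ∀ v ∈ ball (0 : V) (α X), T l t v ∈ ball (0 : V) (α X) →
      E X (chart X (T l t v)) = E X (chart X v))
    (hspan : Dense (Submodule.span ℂ (⋃ l, Set.range (L l)) : Set V))
    (hE : B13.LogHalfBound D sp E nX (A * ((c.L : ℝ) * c.M) ^ 4) r) (hvol : B13.VolBoundK1 D nX c₁)
    (hc₁ : 0 ≤ c₁) :
    B13.Bound118 D sp' (diffAlongV E line) (16 * A * (1 + c₀ ^ 2) / a ^ 2 * c₁) (r - 3) :=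
  B10Eq61PerSite.bound118_secondOrder_of_R21 c h21 hLM hα₀ hα₁ hA hh hH hdom han
    (derivZeroAlongV_of_linearInvariant chart hch T L α hα hdiff hTd hinv hspan) hE hvol hc₁

/-- **`B10Eq61PerSite.logHalfBound_secondOrder_twoRegime_of_R21` with (L3′) discharged on the cut-off evaluation spaces
`below d₀ sp'`** — precisely (v1.1, R-pv27-64): only `hch : InChart chart (below d₀ sp') line` is cut off to the
evaluation configurations with `d(X) ≤ d₀`; `hdiff` and `hinv` are asked for every X, which costs nothing — for
`d(X) > d₀` the set `below d₀ sp' X` is empty, so `chart X` may be taken constant there and (a), (b) hold trivially.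
[cite: Balaban1988RG2Cluster, pp.15, 20–21; Balaban1985UV3, (31)–(32) p.264, p.272] -/
theorem logHalfBound_secondOrder_twoRegime_of_linearInvariant (c : B13.Consts) (h21 : c.R21)
    (hLM : 1 ≤ (c.L : ℝ) * c.M) (hα₀ : 0 ≤ c.α₀) (hα₁ : 0 ≤ c.α₁) {A a c₀ r d₀ : ℝ} (hA : 0 ≤ A)
    (hd₀ : ((c.L : ℝ) * c.M) ^ 4 * Real.exp (-(2 * d₀)) ≤ 1)
    (hh : ∀ X, 0 < h X) (hH : ∀ X, (h X)⁻¹ ≤ (c.α₁ + c₀ * ((c.L : ℝ) * c.M) * c.α₀) / a * (1 + D.dj X))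
    (hend : EndpointsIn sp' sp line) (hdom : LineInStrip (below d₀ sp') sp line h)
    (han : AnalyticOnStrip (below d₀ sp') E line h)
    (chart : D.Dom → V → Φ) (hch : InChart chart (below d₀ sp') line) (T : Λ → ℝ → V →L[ℂ] V)
    (L : Λ → V →L[ℂ] V) (α : D.Dom → ℝ) (hα : ∀ X, 0 < α X)
    (hdiff : ∀ X, DifferentiableAt ℂ (fun v => E X (chart X v)) 0)
    (hTd : ∀ l w, HasDerivAt (fun t => T l t w) (L l w) 0)
    (hinv : ∀ X l t, ∀ v ∈ ball (0 : V) (α X), T l t v ∈ ball (0 : V) (α X) →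
      E X (chart X (T l t v)) = E X (chart X v))
    (hspan : Dense (Submodule.span ℂ (⋃ l, Set.range (L l)) : Set V))
    (hE : B13.LogHalfBound D sp E nX (A * ((c.L : ℝ) * c.M) ^ 4) r) :
    B13.LogHalfBound D sp' (diffAlongV E line) nX (16 * A * (1 + c₀ ^ 2) / a ^ 2 + 2 * A) (r - 2) :=
  B10Eq61PerSite.logHalfBound_secondOrder_twoRegime_of_R21 c h21 hLM hα₀ hα₁ hA hd₀ hh hH hend hdom han
    (derivZeroAlongV_of_linearInvariant chart hch T L α hα hdiff hTd hinv hspan) hE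

end composition

/-! ## §6 Non-vacuity: a non-constant invariant with vanishing first derivative -/

section examples

/-- The hyperbolic one-parameter group on `ℂ × ℂ`: `T_t (a, b) = (eᵗ·a, e⁻ᵗ·b)` (a toy *"R(U)"*). [folklore] -/
noncomputable def hypT (t : ℝ) : ℂ × ℂ →L[ℂ] ℂ × ℂ :=
  (((Real.exp t : ℝ) : ℂ) • ContinuousLinearMap.fst ℂ ℂ ℂ).prod
    (((Real.exp (-t) : ℝ) : ℂ) • ContinuousLinearMap.snd ℂ ℂ ℂ)

/-- Its generator `L (a, b) = (a, −b)`. [folklore] -/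
noncomputable def hypL : ℂ × ℂ →L[ℂ] ℂ × ℂ :=
  (ContinuousLinearMap.fst ℂ ℂ ℂ).prod (-ContinuousLinearMap.snd ℂ ℂ ℂ)

/-- Pointwise form of `hypT`. [folklore] -/
@[simp] theorem hypT_apply (t : ℝ) (w : ℂ × ℂ) :
    hypT t w = (((Real.exp t : ℝ) : ℂ) * w.1, ((Real.exp (-t) : ℝ) : ℂ) * w.2) := by
  simp [hypT]

/-- Pointwise form of `hypL`. [folklore] -/
@[simp] theorem hypL_apply (w : ℂ × ℂ) : hypL w = (w.1, -w.2) := by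
  simp [hypL]

/-- `T₀ = id`. [folklore] -/
theorem hypT_zero (w : ℂ × ℂ) : hypT 0 w = w := by
  simp

/-- `d/dt T_t w = L w` at `t = 0`. [folklore] -/
theorem hasDerivAt_hypT (w : ℂ × ℂ) : HasDerivAt (fun t => hypT t w) (hypL w) 0 := by
  have h1 : HasDerivAt (fun t : ℝ => ((Real.exp t : ℝ) : ℂ) * w.1) (((Real.exp 0 : ℝ) : ℂ) * w.1) 0 :=
    ((Real.hasDerivAt_exp 0).ofReal_comp).mul_const w.1
  have h2 : HasDerivAt (fun t : ℝ => ((Real.exp (-t) : ℝ) : ℂ) * w.2)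
      (((Real.exp (-0) * -1 : ℝ) : ℂ) * w.2) 0 :=
    (((hasDerivAt_neg (0 : ℝ)).exp).ofReal_comp).mul_const w.2
  have h := h1.prodMk h2
  simp only [neg_zero, Real.exp_zero, mul_neg, mul_one, Complex.ofReal_one, one_mul, Complex.ofReal_neg,
    neg_mul] at h
  have hfun : (fun t => hypT t w) =
      fun t : ℝ => (((Real.exp t : ℝ) : ℂ) * w.1, ((Real.exp (-t) : ℝ) : ℂ) * w.2) := by
    funext t; simp
  rw [hfun, hypL_apply]
  exact h

/-- The invariant: `g (a, b) = a·b`, `g (T_t w) = g w`. [folklore] -/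
theorem mul_invariant_hypT (t : ℝ) (w : ℂ × ℂ) : (hypT t w).1 * (hypT t w).2 = w.1 * w.2 := by
  simp only [hypT_apply]
  have h : ((Real.exp t : ℝ) : ℂ) * ((Real.exp (-t) : ℝ) : ℂ) = 1 := by
    rw [← Complex.ofReal_mul, ← Real.exp_add, add_neg_cancel, Real.exp_zero, Complex.ofReal_one]
  calc ((Real.exp t : ℝ) : ℂ) * w.1 * (((Real.exp (-t) : ℝ) : ℂ) * w.2)
        = (((Real.exp t : ℝ) : ℂ) * ((Real.exp (-t) : ℝ) : ℂ)) * (w.1 * w.2) := by ring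
    _ = w.1 * w.2 := by rw [h, one_mul]

/-- The generator is surjective, so its range is (densely) everything. [folklore] -/
theorem dense_span_range_hypL :
    Dense (Submodule.span ℂ (⋃ _l : Unit, Set.range hypL) : Set (ℂ × ℂ)) := by
  have hsurj : Set.range (hypL : ℂ × ℂ → ℂ × ℂ) = Set.univ := by
    ext w
    simp only [Set.mem_range, Set.mem_univ, iff_true]
    exact ⟨(w.1, -w.2), by simp⟩
  have hset : (Submodule.span ℂ (⋃ _l : Unit, Set.range (hypL : ℂ × ℂ → ℂ × ℂ)) : Set (ℂ × ℂ)) = Set.univ := by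
    apply Set.eq_univ_of_univ_subset
    intro w _
    apply Submodule.subset_span
    exact Set.mem_iUnion.2 ⟨(), by rw [hsurj]; exact Set.mem_univ w⟩
  rw [hset]
  exact dense_univ

/-- **Non-vacuity of §2**: the non-constant invariant analytic function `g (a, b) = a·b` satisfies every hypothesis of
`fderiv_eq_zero_of_linearInvariant_ball` (any radius), and indeed `Dg(0) = 0` — invariants of the global group start
at second order, the printed *"no relevant variables"*. [folklore] -/
example : fderiv ℂ (fun w : ℂ × ℂ => w.1 * w.2) 0 = 0 :=
  fderiv_eq_zero_of_linearInvariant_ball (Λ := Unit) one_pos (fun _ t => hypT t) (fun _ => hypL)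
    (differentiableAt_fst.mul differentiableAt_snd) (fun _ w => hasDerivAt_hypT w)
    (fun _ t v _ _ => mul_invariant_hypT t v) dense_span_range_hypL

/-- **Non-vacuity of the leaf theorem**: configurations `Φ = V = ℂ × ℂ` (chart = identity), the family
`E X φ = φ.1·φ.2` (gauge invariant, NOT constant), the straight lines `ζ ↦ ζ•φ` through the unit configuration, any
evaluation spaces: (L3′) follows from `derivZeroAlongV_of_linearInvariant`, no hypothesis being `False`. [folklore] -/
example (sp' : Unit → Set (ℂ × ℂ)) :
    DerivZeroAlongV (D := unitSys) sp' (fun _ φ => φ.1 * φ.2) (fun _ φ ζ => ζ • φ) :=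
  derivZeroAlongV_of_linearInvariant (Λ := Unit) (fun _ v => v)
    (inChart_of_smul (fun _ v => v) (fun _ φ => φ) (fun _ _ _ _ => rfl))
    (fun _ t => hypT t) (fun _ => hypL) (fun _ => 1) (fun _ => one_pos)
    (fun _ => differentiableAt_fst.mul differentiableAt_snd) (fun _ w => hasDerivAt_hypT w)
    (fun _ _ t v _ _ => mul_invariant_hypT t v) dense_span_range_hypL

/-- The example family is genuinely non-trivial: its differenced family does not vanish (at `φ = (1, 1)`). [folklore] -/
example : diffAlongV (D := unitSys) (fun _ (φ : ℂ × ℂ) => φ.1 * φ.2) (fun _ φ ζ => ζ • φ) () (1, 1) ≠ 0 := by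
  simp [diffAlongV]

end examples

end Literature.MathematicalPhysics.QuantumFieldTheory.Balaban1983to89.B13DerivZeroGauge
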